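/-
Copyright (c) 2026 the pub-hodgecm-mathlib formalisation cell (harness21).  Prover seat hodgecm-mathlib-K2Liu-p13 (g2), Track B «K2-LIT»,
#184♮ = hLiu418 = `stmt-HodgeConjecture-24832`; Road I v3 organ U1-CT-ind STAGE 2 (Q2), file F10 — THE (Q2) HEAD IN ONE LINE (★ F4 + ★ F5-f + ★ F5-g + ★ F5-h + ★ F5-r wired).
-/
import Summits.HodgeConjecture.HodgeConjecture.Theorems.K2LiuKlingenConstantTermUnfold          -- ★ F4: `klingenConstTerm_two_cells`
import Summits.HodgeConjecture.HodgeConjecture.Theorems.K2LiuKlingenCellXiEisensteinU           -- ★ F5-g (+ ★ F5-a, ★ F5-f, ★ E1 `eisensteinSeriesU`)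
import Summits.HodgeConjecture.HodgeConjecture.Theorems.K2LiuLatticeStableAutomorphismHaar      -- ★ F5-h: `measurePreserving_conj_transport_klingenLevi`
import HarnessLib

/-!
# Crux `HLiu418`, Road I v3, organ U1 stage 2 (Q2), file F10: THE Q-CONSTANT TERM OF THE DOUBLED SIEGEL EISENSTEIN SERIES ALONG THE KLINGEN LEVI IS THE SUM OF TWO E1 BOREL
# EISENSTEIN SERIES — `CT_Q(E(f))(Ψ(m_Q(1,g₂))·h) = (∫β) · eisensteinSeriesU S_h g₂ + eisensteinSeriesU F_h g₂`

Cell `hodgecm-mathlib`, crux item hLiu418 = `stmt-HodgeConjecture-24832`; squad K2 ∕ K2Liu; LEAD F0P6-plan (g14), co-dealer K2E5-plan (g7); prover K2Liu-p13 (g2).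
THEOREMS ONLY (no `def`, no instance, no notation, no named-fact hypothesis, no `sorry`); lane `--supports stmt-HodgeConjecture-24832 --as helper` (count-neutral).
THE (Q2) HEAD IN ONE LINE: ★ F4 `klingenConstTerm_two_cells` (two cells under (H)) + ★ F5-f `tsum_cellOne_eq_eisensteinSeriesU` (identity cell = `eisensteinSeriesU S_h`) + ★ F5-g
`tsum_cellXi_eq_eisensteinSeriesU` (`ξ`-cell = `eisensteinSeriesU F_h`) with ★ F5-g's binder `hconj` DISCHARGED by ★ F5-h (Haar `νN`; `N_Q(𝔸)` locally compact and second countable — ★ F5-r,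
here as instance hypotheses):
* **`klingenConstTerm_eq_eisensteinSeriesU_add`**: for `h ∈ H(𝔸)`, `g₂ ∈ U(J₂)(𝔸_{L⁺})`,
  `∫ β(u) • E^Δ(u · Ψ(jAdelic₄ m_Q^𝔸(1, j₂⁻¹g₂)) · h; f) dνN(u) = (∫ β dνN) • eisensteinSeriesU S_h g₂ + eisensteinSeriesU F_h g₂`,
  `S_h y = f(Ψ(jAdelic₄ m_Q^𝔸(1, j₂⁻¹y)) · h)` (★ F5-d∕F7: Borel section at E1's `s + ½`), `F_h y = ∫ β₁(u) • f(Ψ(toAdelic ξ) · u · Ψ(jAdelic₄ m_Q^𝔸(1, j₂⁻¹y)) · h) dνN(u)` (★ F5-c∕F8∕F5-q: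
  `= C · F′_h`, Borel section at `s − ½`); the sections are left-`B₂(L⁺)`-invariant (★ F5-j ∕ ★ F5-q) so both series are E1 Borel Eisenstein series of `U(J₂)` in the sense of
  ★ `K2E1BorelEisensteinUDefs` (automorphic: ★ E1 `eisensteinSeriesU_rational_mul`), and (T3) holds (★ F6).
[MoeglinWaldspurger1995, II.1.7 (ii)], [Xiong2013, §4 Prop. 4.1], [GanTakeda2011SiegelWeil, §7.2 p. 23], [KudlaRallis1994, §2], [Rogawski1990, §2.2].
HONEST LABEL.  Count-neutral helper: `HC_CM` is proved only modulo the 7 printed citations (2 remaining named inputs: hLiu418 = `stmt-HodgeConjecture-24832`,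
h413 = `stmt-HodgeConjecture-24833`) until rung 0 closes.
-/

set_option autoImplicit false
set_option linter.dupNamespace false -- the mandated namespace repeats `HodgeConjecture.HodgeConjecture`

noncomputable section

open scoped Matrix ENNReal NNReal
open NumberField IsDedekindDomain MeasureTheory MeasureTheory.Measure MulAction

namespace Summit.HodgeConjecture.HodgeConjecture.Cruxes.HLiu418.K2LiuKlingenConstantTermEisensteinU

open Literature.MeasureTheory.Group
open Literature.NumberTheory.Automorphic Literature.NumberTheory.Automorphic.UnitaryGroup
open Literature.NumberTheory.GelbartRogawski1991 Literature.NumberTheory.GelbartRogawski1991.GRConstruction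
open Literature.NumberTheory.GaloisRepresentations
open Literature.NumberTheory.K2Lit.SiegelDoubled
open Summit.HodgeConjecture.HodgeConjecture.Cruxes.HLiu418.K2LiuDoubledUTwoTwoBorelFrame
open Summit.HodgeConjecture.HodgeConjecture.Cruxes.HLiu418.K2LiuKlingenParabolicDefs
open Summit.HodgeConjecture.HodgeConjecture.Cruxes.HLiu418.K2LiuKlingenUnipotentAdelicDefs
open Summit.HodgeConjecture.HodgeConjecture.Cruxes.HLiu418.K2LiuKlingenRationalCells (complexConj_ringHom_apply_apply)
open Summit.HodgeConjecture.HodgeConjecture.Cruxes.HLiu418.K2LiuKlingenCellOneConstant (conj_mem_klingenUnipA)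
open Summit.HodgeConjecture.HodgeConjecture.Cruxes.HLiu418.K2LiuKlingenConstantTermUnfold (klingenConstTerm_two_cells)
open Summit.HodgeConjecture.HodgeConjecture.Cruxes.HLiu418.K2LiuKlingenCellOneEisensteinU (tsum_cellOne_eq_eisensteinSeriesU)
open Summit.HodgeConjecture.HodgeConjecture.Cruxes.HLiu418.K2LiuKlingenCellXiEisensteinU (tsum_cellXi_eq_eisensteinSeriesU)
open Summit.HodgeConjecture.HodgeConjecture.Cruxes.HLiu418.K2LiuLatticeStableAutomorphismHaar (measurePreserving_conj_transport_klingenLevi)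
open Summit.HodgeConjecture.HodgeConjecture.Cruxes.HLiu418.K2LiuSiegelDoubledLeviMatrix (conjAdele_conjAdele')
open Summit.HodgeConjecture.HodgeConjecture.Cruxes.H413.K2E1BorelEisensteinU (eisensteinSeriesU)
open UnitaryDualPair

variable {L : Type} [Field L] [NumberField L] [IsCMField L]
variable {N M : ℕ} {e : Fin N × Fin M ≃ Fin 2}
  {dV : Fin N → L} {hdV : ∀ i, IsCMField.complexConj L (dV i) = dV i}
  {dW : Fin M → L} {hdW : ∀ i, IsCMField.complexConj L (dW i) = dW i}

section Transport

variable {SA : GL (Fin (2 + 2)) (AdeleRing (𝓞 L) L)}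
  {Ψ : (quasiSplit (Fp L) L (IsCMField.complexConj L) (2 + 2)).Adelic ≃ₜ* HA L e dV hdV dW hdW} {X Y : Matrix (Fin 2) (Fin 2) (Fp L)} {a : Fp L}
  (hΨ : ∀ g : (quasiSplit (Fp L) L (IsCMField.complexConj L) (2 + 2)).Adelic,
    (((Ψ g : HA L e dV hdV dW hdW) : GL (Fin (2 + 2)) (AdeleRing (𝓞 L) L)) : Matrix (Fin (2 + 2)) (Fin (2 + 2)) (AdeleRing (𝓞 L) L)) =
      (SA : Matrix (Fin (2 + 2)) (Fin (2 + 2)) (AdeleRing (𝓞 L) L)) *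
        ((adelicVal (Fp L) L (IsCMField.complexConj L) (2 + 2) _ g : GL (Fin (2 + 2)) (AdeleRing (𝓞 L) L)) :
          Matrix (Fin (2 + 2)) (Fin (2 + 2)) (AdeleRing (𝓞 L) L)) *
        ((SA⁻¹ : GL (Fin (2 + 2)) (AdeleRing (𝓞 L) L)) : Matrix (Fin (2 + 2)) (Fin (2 + 2)) (AdeleRing (𝓞 L) L)))
  (ha : a + a = 1)
  (hSA : Matrix.reindex (e₂ (n := 2)).symm (e₂ (n := 2)).symm (SA : Matrix (Fin (2 + 2)) (Fin (2 + 2)) (AdeleRing (𝓞 L) L)) =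
    Matrix.fromBlocks (1 : Matrix (Fin 2) (Fin 2) (AdeleRing (𝓞 L) L)) (X.map ((algebraMap L (AdeleRing (𝓞 L) L)).comp (algebraMap (Fp L) L))) 1
      (-(X.map ((algebraMap L (AdeleRing (𝓞 L) L)).comp (algebraMap (Fp L) L)))))
  (hSAi : Matrix.reindex (e₂ (n := 2)).symm (e₂ (n := 2)).symm ((SA⁻¹ : GL (Fin (2 + 2)) (AdeleRing (𝓞 L) L)) : Matrix (Fin (2 + 2)) (Fin (2 + 2)) (AdeleRing (𝓞 L) L)) =
    Matrix.fromBlocks ((a • (1 : Matrix (Fin 2) (Fin 2) (Fp L))).map ((algebraMap L (AdeleRing (𝓞 L) L)).comp (algebraMap (Fp L) L)))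
      ((a • (1 : Matrix (Fin 2) (Fin 2) (Fp L))).map ((algebraMap L (AdeleRing (𝓞 L) L)).comp (algebraMap (Fp L) L)))
      (Y.map ((algebraMap L (AdeleRing (𝓞 L) L)).comp (algebraMap (Fp L) L)))
      (-(Y.map ((algebraMap L (AdeleRing (𝓞 L) L)).comp (algebraMap (Fp L) L)))))
  (hXY : X * Y = a • (1 : Matrix (Fin 2) (Fin 2) (Fp L))) (hYX : Y * X = a • (1 : Matrix (Fin 2) (Fin 2) (Fp L)))
  (hΨP : ∀ b : (quasiSplit (Fp L) L (IsCMField.complexConj L) (2 + 2)).Adelic,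
    ((adelicVal (Fp L) L (IsCMField.complexConj L) (2 + 2) _ b : GL (Fin (2 + 2)) (AdeleRing (𝓞 L) L)) :
        Matrix (Fin (2 + 2)) (Fin (2 + 2)) (AdeleRing (𝓞 L) L)).BlockTriangular id →
      IsSiegelDelta L e dV hdV dW hdW (Ψ b))

include hΨ ha hSA hSAi hΨP hXY hYX in
/-- **(Q2) HEAD — `CT_Q(E(f))(Ψ(m_Q(1,g₂))·h) = (∫β) · eisensteinSeriesU S_h g₂ + eisensteinSeriesU F_h g₂`.**  `νN` a Haar measure on `N_Q(𝔸) = klingenUnipA Ψ` (locally compact,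
second countable: ★ F5-r), `β` an `N_Q(L⁺)`-covering weight with `∫ β dνN ≠ 0, ∞`, `f` a continuous Siegel section of `I_Δ(s,χ)` with (H) at the point `Ψ(jAdelic m_Q(1,j₂⁻¹g₂))·h`
(absolute convergence of the unfolded Siegel Eisenstein series against `β`), `C₁` the identity cell (membership law), `Γ₁` the stabiliser lattice of the `ξ`-cell (★ F5-a's letter) with a
`Γ₁`-covering weight `β₁`. [cite: MoeglinWaldspurger1995, II.1.7] [cite: Xiong2013, §4 Prop. 4.1] [cite: GanTakeda2011SiegelWeil, §7.2 p. 23] -/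
theorem klingenConstTerm_eq_eisensteinSeriesU_add [MeasurableSpace ↥(klingenUnipA Ψ)] [BorelSpace ↥(klingenUnipA Ψ)]
    [LocallyCompactSpace ↥(klingenUnipA Ψ)] [SecondCountableTopology ↥(klingenUnipA Ψ)]
    (νN : Measure ↥(klingenUnipA Ψ)) [νN.IsHaarMeasure]
    {β : ↥(klingenUnipA Ψ) → ℝ≥0∞} (hβ : IsCoveringWeight ↥((ratH L e dV hdV dW hdW).subgroupOf (klingenUnipA Ψ)) β)
    (hβ0 : ∫⁻ u, β u ∂νN ≠ 0) (hβtop : ∫⁻ u, β u ∂νN ≠ ∞)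
    {χ : HeckeCharacter L} {s : ℂ} {f : HA L e dV hdV dW hdW → ℂ} (hf : IsSiegelDeltaSection L e dV hdV dW hdW χ s f) (hfc : Continuous f)
    (h : HA L e dV hdV dW hdW) (g₂ : (quasiSplit (Fp L) L (IsCMField.complexConj L) 2).Adelic)
    (hH : ∫⁻ u, (∑' x : SiegelDeltaQuot L e dV hdV dW hdW,
        ‖f ((((Quotient.out x : ratH L e dV hdV dW hdW) : HA L e dV hdV dW hdW)) * ((u : HA L e dV hdV dW hdW) * (Ψ (jAdelic L 4 (klingenLevi (AdeleRing (𝓞 L) L) (conjAdele (Fp L) L (IsCMField.complexConj L)) (conjAdele_conjAdele' L) 1 ((jAdelic L 2).symm g₂))) * h)))‖ₑ) * β u ∂νN ≠ ∞)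
    (C₁ : Set (SiegelDeltaQuot L e dV hdV dW hdW))
    (hC₁ : ∀ x, x ∈ C₁ ↔ ∃ q ∈ klingen L ((IsCMField.complexConj L : L ≃ₐ[Fp L] L) : L →+* L), ∃ γ : ratH L e dV hdV dW hdW,
      (γ : HA L e dV hdV dW hdW) = Ψ (UnitaryGroup.toAdelic (Fp L) L (IsCMField.complexConj L) (2 + 2) ((StdForm.antidiagonal (2 + 2)).over L) q) ∧ x = Quotient.mk (MulAction.orbitRel (siegelDeltaRat L e dV hdV dW hdW) (ratH L e dV hdV dW hdW)) γ)
    (Γ₁ : Subgroup ↥(klingenUnipA Ψ))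
    (hΓ₁ : ∀ u : ↥(klingenUnipA Ψ), u ∈ Γ₁ ↔ (u : HA L e dV hdV dW hdW) ∈ ratH L e dV hdV dW hdW ∧
      IsSiegelDelta L e dV hdV dW hdW (Ψ (UnitaryGroup.toAdelic (Fp L) L (IsCMField.complexConj L) (2 + 2) ((StdForm.antidiagonal (2 + 2)).over L) (weylXi L ((IsCMField.complexConj L : L ≃ₐ[Fp L] L) : L →+* L))) * (u : HA L e dV hdV dW hdW) * (Ψ (UnitaryGroup.toAdelic (Fp L) L (IsCMField.complexConj L) (2 + 2) ((StdForm.antidiagonal (2 + 2)).over L) (weylXi L ((IsCMField.complexConj L : L ≃ₐ[Fp L] L) : L →+* L))))⁻¹))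
    {β₁ : ↥(klingenUnipA Ψ) → ℝ≥0∞} (hβ₁ : IsCoveringWeight ↥Γ₁ β₁) :
    ∫ u, (β u).toReal • eisensteinSeriesDelta L e dV hdV dW hdW f ((u : HA L e dV hdV dW hdW) * (Ψ (jAdelic L 4 (klingenLevi (AdeleRing (𝓞 L) L) (conjAdele (Fp L) L (IsCMField.complexConj L)) (conjAdele_conjAdele' L) 1 ((jAdelic L 2).symm g₂))) * h)) ∂νN =
      (∫ u, (β u).toReal ∂νN) • eisensteinSeriesU (fun y : (quasiSplit (Fp L) L (IsCMField.complexConj L) 2).Adelic => f (Ψ (jAdelic L 4 (klingenLevi (AdeleRing (𝓞 L) L) (conjAdele (Fp L) L (IsCMField.complexConj L)) (conjAdele_conjAdele' L) 1 ((jAdelic L 2).symm y))) * h)) g₂ +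
        eisensteinSeriesU (fun y : (quasiSplit (Fp L) L (IsCMField.complexConj L) 2).Adelic =>
          ∫ u, (β₁ u).toReal • f (Ψ (UnitaryGroup.toAdelic (Fp L) L (IsCMField.complexConj L) (2 + 2) ((StdForm.antidiagonal (2 + 2)).over L) (weylXi L ((IsCMField.complexConj L : L ≃ₐ[Fp L] L) : L →+* L))) * (u : HA L e dV hdV dW hdW) * (Ψ (jAdelic L 4 (klingenLevi (AdeleRing (𝓞 L) L) (conjAdele (Fp L) L (IsCMField.complexConj L)) (conjAdele_conjAdele' L) 1 ((jAdelic L 2).symm y))) * h)) ∂νN) g₂ := by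
  have hconj := measurePreserving_conj_transport_klingenLevi hΨ ha hSA hSAi hXY hYX νN hβ hβ0 hβtop
  rw [klingenConstTerm_two_cells hΨ ha hSA hSAi hΨP νN hβ.1 hβ.le_one hf hfc _ hH C₁ hC₁,
    tsum_cellOne_eq_eisensteinSeriesU hΨ ha hSA hSAi hXY hYX C₁ hC₁ hf h g₂,
    ← tsum_cellXi_eq_eisensteinSeriesU hΨ ha hSA hSAi hXY hYX νN hβ hf hfc h g₂ hH C₁ hC₁ Γ₁ hΓ₁ hβ₁ hconj]

end Transport

end Summit.HodgeConjecture.HodgeConjecture.Cruxes.HLiu418.K2LiuKlingenConstantTermEisensteinU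

end
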